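import Summits.ResolutionOfSingularities.ResolutionOfSingularities.Theses.RuledResidues
import Summits.ResolutionOfSingularities.ResolutionOfSingularities.Theorems.NonRuledDivisors.Negative.NoAlgebraicWitness
import Summits.ResolutionOfSingularities.ResolutionOfSingularities.Theorems.NonRuledDivisors.Negative.OrbitGermEngineANotSurjective
import Summits.ResolutionOfSingularities.ResolutionOfSingularities.Theorems.NonRuledDivisors.Negative.OrbitGermEngineBTranscendentalConstants
import Summits.ResolutionOfSingularities.ResolutionOfSingularities.Theorems.NonRuledDivisors.Negative.OrbitGermEngineANotIntegral
import Summits.ResolutionOfSingularities.ResolutionOfSingularities.Theorems.NonRuledDivisors.Negative.WithoutSingularCentreHolds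
import Summits.ResolutionOfSingularities.ResolutionOfSingularities.Theorems.NonRuledDivisors.Negative.OrbitStubsTightness
import Summits.ResolutionOfSingularities.ResolutionOfSingularities.Theorems.NonRuledDivisors.Negative.CuspMember

/-!
# Disproof of `NonRuledDivisors` (stmt-ResolutionOfSingularities-18075) — findings

Work file of the crux DISPROVER (`refuter-cdisprove-stmt-ResolutionOfSingularities-18075-0`,
cycle 1, 2026-08-17).  Route `RuledResidues` is REFUTATION-SHAPED
(`closes : NonRuledDivisors → RegularModelRuled → NonRuledCofinite → ¬ ResolutionOfSingularities`)
and this crux is THE WITNESS: an affine model `R` of `K/k` (char `p`) with INFINITELY MANY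
divisorial places over `Sing R` whose residue fields are not ruled over `k`.

## Verdict of cycle 1: NO KILL — the crux is an honest open problem, faithfully typed

* `¬ NonRuledDivisors` = "NRF": for every `k, K, R` the non-ruled divisorial places over `Sing R`
  are finitely many.  NRF is implied by the summit (via the route's two kills, both TRUE as typed —
  checked informally here and by the batch refuter / route review) and is OPEN in `trdeg_k K ≥ 4`;
  the only resolution-free engine (de Jong alterations) gives cofinite UNIruledness, not ruledness.
  So an unconditional `¬ C` would be a new theorem strictly between nothing and `Res_p`; no finite
  model, no decidable instance, no `kit` computation can decide `C` (a witness needs infinitely many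
  individually certified non-ruled places; a refutation needs NRF).
* Typing read-back (§1): faithful — no junk witness (every junk candidate examined is finite by
  surface / threefold resolution + the kills), no junk refutation: the five-clause set-builder is
  JOINTLY SATISFIABLE, formally — `nonRuledDivisors_withNonempty_holds` (LANDED p155651,
  `Negative/CuspMember.lean`): over the CUSP `R = 𝔽₂[X², X³] ⊆ 𝔽₂(X)` the place `W = 𝔽₂[X]_(X)` is
  a typed member (DVR, essentially of finite type, residue field `𝔽₂` hence not ruled, centre NOT
  regular — proved via Matsumura 19.4 in tree: `X = X³/X²` is integral over `R_𝔭` and not in it);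
  so the crux with `Set.Infinite` weakened to `Set.Nonempty` HOLDS and only INFINITUDE is at stake.

## What IS proved (sorry-free; ALL landed under `Theorems/NonRuledDivisors/Negative/`, imported
## above and restated in §2–§4 in this namespace)

* §2 `witnessSet_eq_empty_of_isAlgebraic` (LANDED p153515, `Negative/NoAlgebraicWitness.lean`):
  if `K/k` is algebraic the witness set is EMPTY for every `R` (places `⊇ k` are integrally closed
  ⇒ `W = K`, not a DVR); the crux strengthened by `Algebra.IsAlgebraic k K` is false.  (Regime map,
  informal: trdeg 1 finite by Krull–Akizuki; trdeg 2, 3 finite by Lipman 1978 / Cossart–Piltant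
  2019 + the kills ⇒ a witness has `trdeg_k K ≥ 4`; typed as the near-miss
  `witnessSet_finite_of_trdeg_le_three`, §4 — the ONLY `sorry` of this file.)
* §4 `nonRuledDivisorsWithoutSingularCentre_holds` (LANDED p154560,
  `Negative/WithoutSingularCentreHolds.lean`): the SINGULAR-CENTRE clause is LOAD-BEARING — delete
  `¬ IsRegularLocalRing (R at the centre)` (keep `R ⊆ W`, all else verbatim) and the crux HOLDS:
  `p = 2`, `k = 𝔽̄₂`, `K = k(X)`, `R = k[X]`, the linear places `W_a = k[X]_(X−a)` (DVR, essentially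
  of finite type, residue field `= k` hence never ruled, `a ↦ W_a` injective).  In trdeg 1
  "non-ruled" is automatic; the clause (with trdeg ≥ 2) is what ties the crux to resolution.
* §3 line `automorphism-orbit` (registered skeleton `Lines/automorphism_orbit.lean`):
  - stubs 2 (`stub_transportStep`) and 3 (`stub_contractingInjective`) are TRUE as typed (audit in
    §3, no kill); stub 4 is proved (strategist, evidence `StubModulus.lean`); stub 1
    (`stub_orbitGerm`) is the hunt — its negation is again NRF-hard in general, but its two
    certificates have resolution-free EMPTY CORNERS, landed as Negative lemmas:
  - engine (A) `P ≠ ⊥ ∧ τP ⊆ P²` is VOID when `τ` maps `R` ONTO `R` (LANDED p153573,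
    `Negative/OrbitGermEngineANotSurjective.lean`: Noetherian chain `P ⊆ τ⁻¹P ⊆ …` ⇒ `P = τP ⊆ P²`
    ⇒ `P` idempotent ⇒ `⊥/⊤`), and VOID when `R` is NORMAL and integral over `τR` (LANDED p154279,
    `Negative/OrbitGermEngineANotIntegral.lean`: finite birational endomorphisms of normal models
    are onto).  So an engine-(A) map is a NON-FINITE birational endomorphism of the germ contracting
    a positive-dimensional subvariety into `P`; automorphisms, finite self-covers, Frobenius-like
    and Galois-like maps, finite group actions never serve.
  - engine (B) `∀ n > 0, ιⁿ a ≠ a` is VOID over every `k` algebraic over `𝔽_p` (LANDED p153574,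
    `Negative/OrbitGermEngineBTranscendentalConstants.lean`: the `Aut k`-orbit of `a` lies in the
    root set of its `𝔽_p`-polynomial).  So a B-germ needs a constant transcendental over `𝔽_p`
    (consistent with the strategist's habitat `k ⊋ 𝔽̄_p(a)` and the Ohm obstruction of card
    `Ideas/ohm-inseparable-residue-growth.md`).
  - tightness of the true stubs (LANDED p154702 pending at write time,
    `Negative/OrbitStubsTightness.lean`): stub 3 is FALSE without `P ≠ ⊥` and FALSE without the
    contraction `τP ⊆ P²`; stub 4 is FALSE without the infinite `ι`-orbit (identity automorphism
    on `𝔽₂[X]_(X)`, constant orbit) — every certificate hypothesis is load-bearing.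

## Why it resists (for the provers = witness hunters) — §4

Every cheap attack on `C` reduces to NRF in some regime: (i) degenerate regimes are EMPTY or FINITE
for classical reasons (above); (ii) mutations: dropping `Sing`-centre, `non-ruled` or `Infinite`
makes `C` TRUE (the typed `Sing`-mutation is PROVED, §4; `non-ruled`/`Infinite` mutations hold
informally by height-one primes of general type resp. any single member), dropping `DVR` changes
nothing (redundant given the
essentially-finite-type clause + centre ≠ ⊥); so every conjunct is load-bearing and none is
refutable; (iii) no barrier of `Literature/Barriers/ResolutionOfSingularities/` bites an
existential witness statement (they constrain PROCESSES); (iv) literature (degraded this session: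
searchd reset, OpenAlex 429): no published variety with infinitely many essential / non-uniruled
divisorial valuations over its singular locus is known to this seat (it would refute `Res_p`), and
no resolution-free proof of cofinite ruledness is known (Ishii–Kollár math/0207171 Ex. 2.5 uses a
resolution; de Jong gives uniruled only; Knaf–Kuhlmann uniformise ONE Abhyankar place with a
1-dimensional regular centre, which says nothing about ruledness).

## Cycle-2 targets (if re-armed), in order of value/cost
1. `orbitGerm_engineB_ruled_of_separablyClosed` (card B1): Ohm's ruled residue theorem + inertia ⇒
   over separably closed `k ⊇ 𝔽̄_p(a)` every modulus place is RULED — needs Ohm vendored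
   (`Literature/FieldTheory/Valuation/OhmRuledResidue.lean`, L-size).
2. `witnessSet_finite_of_trdeg_one` (Krull–Akizuki + finiteness of normalisation, M/L-size) —
   first formal instalment of the regime map.
3. `stub_transportStep_false_without_singular` (drop `¬ IsRegularLocalRing R_P`: with `P = ⊥` an
   automorphism can move a singular centre to a regular one) — needs ONE typed non-ruled place
   over a singular point (genus certificate; M/L-size) — the same object every positive seat needs.
4. toric no-go for engine (A) (toric resolution in Lean — XL, not recommended).
-/

set_option linter.unusedVariables false
set_option linter.dupNamespace false

namespace Summit.ResolutionOfSingularities.ResolutionOfSingularities.Cruxes.NonRuledDivisors.Disproof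

open Summit.ResolutionOfSingularities.ResolutionOfSingularities.Theses.RuledResidues
open Summit.ResolutionOfSingularities.ResolutionOfSingularities.Theorems

/-! ## §0  The witness set of the crux, factored out (verbatim body) -/

/-- The set the crux wants INFINITE: valuation rings `W ⊇ k` of `K`, DVR, essentially of finite
type over `k`, containing `R` and centred at a NON-regular point of `Spec R`, with residue field NOT
ruled over `k`.  Verbatim the set-builder of `RuledResidues.NonRuledDivisors`
(`nonRuledDivisors_iff` is `Iff.rfl`). -/
def witnessSet (k K : Type) [Field k] [Field K] [Algebra k K] (R : Subalgebra k K) :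
    Set (ValuationSubring K) :=
  {W : ValuationSubring K | ∃ hk : (∀ c : k, algebraMap k K c ∈ W), IsDiscreteValuationRing W ∧ (∃ B : Subalgebra k K, B.FG ∧ B.toSubring ≤ W.toSubring ∧ ∀ x : K, x ∈ W → ∃ b s : K, b ∈ B ∧ s ∈ B ∧ s ∉ W.nonunits ∧ x * s = b) ∧ (∃ h : R.toSubring ≤ W.toSubring, ¬ IsRegularLocalRing (Localization.AtPrime (Ideal.comap (Subring.inclusion h) (IsLocalRing.maximalIdeal W)))) ∧ ¬ (∃ (L : Subfield (IsLocalRing.ResidueField W)) (t : IsLocalRing.ResidueField W), (∀ c : k, IsLocalRing.residue W ⟨algebraMap k K c, hk c⟩ ∈ L) ∧ (∀ f : Polynomial L, f ≠ 0 → Polynomial.eval₂ L.subtype t f ≠ 0) ∧ (∀ x : IsLocalRing.ResidueField W, ∃ f g : Polynomial L, Polynomial.eval₂ L.subtype t g ≠ 0 ∧ x * Polynomial.eval₂ L.subtype t g = Polynomial.eval₂ L.subtype t f))}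

/-- The crux, with its set-builder named. -/
theorem nonRuledDivisors_iff :
    NonRuledDivisors ↔ ∃ p : ℕ, p.Prime ∧ ∃ (k K : Type) (_ : Field k) (_ : CharP k p) (_ : Field K)
      (_ : Algebra k K), ∃ R : Subalgebra k K, R.FG ∧ IsFractionRing R K ∧
        (witnessSet k K R).Infinite :=
  Iff.rfl

/-! ## §1  Typing read-back (symbol by symbol) — FAITHFUL

* `R : Subalgebra k K`, `R.FG`, `IsFractionRing ↥R K` with `Algebra ↥R K` = the inclusion: `K` is a
  finitely generated field extension of `k`, `R` an affine model.  `p` only enters via `CharP k p`.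
* `hk : ∀ c, algebraMap k K c ∈ W`: `k ⊆ W`.  `IsDiscreteValuationRing ↥W`: Mathlib's (PID local
  domain, not a field).  REDUNDANT given the next two clauses (a Noetherian valuation ring `≠ K` is a
  DVR; `W ≠ K` because the centre clause needs a non-regular, hence non-field, localisation) —
  harmless.
* essentially-finite-type clause: `B` f.g., `B ⊆ W`, every `x ∈ W` is `b/s` with `b, s ∈ B`,
  `s ∉ W.nonunits` (⇔ `W.valuation s ≥ 1` ⇔ `s` a unit of `W`, since `s ∈ B ⊆ W`; `0 ∈ nonunits`
  so `s ≠ 0`).  Hence `W = B_𝔮`, `Frac B = K`, `ht 𝔮 = 1`, `trdeg_k κ(W) = trdeg_k K − 1`: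
  `W` is a prime divisor of `K/k` (divisorial), exactly as intended.
* centre clause: `Ideal.comap (Subring.inclusion h) (maximalIdeal W)` is the centre `𝔭 = 𝔪_W ∩ R`
  (prime, instance found), `Localization.AtPrime` is `R_𝔭` (Noetherian local), and
  `¬ IsRegularLocalRing R_𝔭` (Mathlib: `spanFinrank 𝔪 = ringKrullDim`) = genuinely singular point.
  Centres may be NON-closed points of `Sing R` — intended and harmless (over a non-closed regular
  centre of dim ≥ 2 Abhyankar still gives ruledness over `κ(centre) ⊇ k`).
* ruledness clause: `∃ L : Subfield κ(W), t`, image of `k` in `L`, `t` transcendental over `L`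
  (`∀ f ≠ 0, f(t) ≠ 0`), `κ(W) = L(t)` (`x·g(t) = f(t)`, `g(t) ≠ 0`): Abhyankar's "ruled over k".
  NB the witness OWNS `k`: a larger `k` makes ruledness HARDER (fewer admissible `L`), so hunters
  should take `k` relatively algebraically closed in `K` only if convenient — but `k ⊆ W` and
  `R` a `k`-algebra tie `k` to the constants anyway.
* quantifier order / universes: `∃ p k K R, Set.Infinite {W | …}` — matches the informal text;
  `k K : Type` (universe 0) is no restriction in practice.
-/

/-! ## §2  Regime exclusion `trdeg_k K = 0` (LANDED p153515) -/

/-- If `K/k` is algebraic the witness set is EMPTY (restates the landed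
`Theorems.nonRuledDivisors_noWitness_of_isAlgebraic`). -/
theorem witnessSet_eq_empty_of_isAlgebraic {k K : Type} [Field k] [Field K] [Algebra k K]
    [Algebra.IsAlgebraic k K] (R : Subalgebra k K) : witnessSet k K R = ∅ :=
  Set.eq_empty_iff_forall_notMem.mpr fun W => nonRuledDivisors_noWitness_of_isAlgebraic R W

/-- … so the crux strengthened by `Algebra.IsAlgebraic k K` is false (landed). -/
theorem not_nonRuledDivisors_with_isAlgebraic :
    ¬ ∃ p : ℕ, p.Prime ∧ ∃ (k K : Type) (_ : Field k) (_ : CharP k p) (_ : Field K)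
      (_ : Algebra k K), Algebra.IsAlgebraic k K ∧ ∃ R : Subalgebra k K, R.FG ∧ IsFractionRing R K ∧
        (witnessSet k K R).Infinite :=
  nonRuledDivisors_false_with_isAlgebraic

/-! ## §2b  Satisfiability: ONE typed member over the cusp (LANDED p155651) -/

/-- The crux with `Set.Infinite` weakened to `Set.Nonempty` HOLDS (`p = 2`, `k = 𝔽₂`, `K = k(X)`,
`R = k[X², X³]`, `W = k[X]_(X)`; restates `Theorems.nonRuledDivisors_withNonempty_holds`).  So no
conjunct of the set-builder, nor their conjunction, is refutable; the crux is exactly the question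
whether such members can be INFINITELY many over one singular locus (¬NRF). -/
theorem nonRuledDivisors_withNonempty_holds' :
    ∃ p : ℕ, p.Prime ∧ ∃ (k K : Type) (_ : Field k) (_ : CharP k p) (_ : Field K)
      (_ : Algebra k K), ∃ R : Subalgebra k K, R.FG ∧ IsFractionRing R K ∧
        (witnessSet k K R).Nonempty :=
  nonRuledDivisors_withNonempty_holds

/-! ## §3  Line `automorphism-orbit`: stub audit and the empty corners of the two engines

STUB AUDIT (informal, against the typed signatures in `Lines/automorphism_orbit.lean`):
* `stub_transportStep` — TRUE as typed.  `k ⊆ W'` from `τ(c·1) = ι c·1`; `W' ≃+* W` by restricting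
  `τ` (so DVR); `B' = τ⁻¹B = adjoin k (τ⁻¹ gens)` (uses `τ⁻¹(k·1) = k·1`, i.e. `ι` onto — it is a
  `RingEquiv`), `B' ⊆ W'` with the `b/s` property pulled back; `R ⊆ W'` from `τR ⊆ R ⊆ W`; the new
  centre `Q = {r | τ r ∈ 𝔪_W} ⊇ P` and `R_P = (R_Q)_P`, so `R_Q` regular ⇒ `R_P` regular (Serre,
  in tree: `isRegularLocalRing_localization_atPrime`) — contrapositive gives the singular-centre
  clause WITHOUT needing `R` Noetherian; non-ruledness transfers along the `ι`-semilinear residue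
  isomorphism (a ruling `(L', t')` of `κ(W')` pushes to `(θL', θt')`, and `θ(k) = ι(k) = k`).
  `W'.nonunits = τ⁻¹(W.nonunits)` gives domination.  No kill.
* `stub_contractingInjective` — TRUE as typed.  Equal members `m < n` give `W = W.comap τᵈ`, so
  `τᵈ` restricts to a ring automorphism of the DVR `W`, which preserves its normalised valuation
  `v`; elements of `P²` have `v ≥ 2·m₀` where `m₀ = min v(P∖0) ≥ 1` (domination), but the
  minimiser `r` has `τᵈ r ∈ P²` and `v(τᵈ r) = v(r) = m₀` — contradiction.  Needs `P ≠ ⊥` (given).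
  No kill.
* `stub_modulusInjective` — proved sorry-free by the strategist (evidence `StubModulus.lean`).
* `stub_orbitGerm` — the hunt.  Its negation is NRF-hard in general; the two typed certificates
  have the following resolution-free EMPTY CORNERS.
-/

section EngineA

/-- §3a (LANDED p153573).  Engine (A) is void when `τ` maps the affine model onto itself
(restates `Theorems.orbitGerm_engineA_false_of_surjOn`). -/
theorem engineA_void_of_surjOn {k K : Type} [Field k] [Field K] [Algebra k K]
    (R : Subalgebra k K) (hR : R.FG) (P : Ideal R.toSubring) [P.IsPrime] (τ : K ≃+* K)
    (hRτ : ∀ r : K, r ∈ R → τ r ∈ R) (hsurj : ∀ r : K, r ∈ R → ∃ r' : K, r' ∈ R ∧ τ r' = r) :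
    ¬ (P ≠ ⊥ ∧ ∀ r : R.toSubring, r ∈ P → ∃ r' : R.toSubring, r' ∈ P ^ 2 ∧ (r' : K) = τ (r : K)) :=
  orbitGerm_engineA_false_of_surjOn R hR P τ hRτ hsurj

/-- §3b (LANDED p154279).  Normality forces a FINITE contraction to be onto
(restates `Theorems.orbitGerm_surjOn_of_integral`). -/
theorem surjOn_of_integral {K : Type*} [Field K] (S : Subring K) (τ : K ≃+* K)
    (hnorm : ∀ x : K, IsIntegral S x → x ∈ S)
    (hint : ∀ r : K, r ∈ S → IsIntegral (S.map (τ : K →+* K)) r) :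
    ∀ r : K, r ∈ S → ∃ r' : K, r' ∈ S ∧ τ r' = r :=
  orbitGerm_surjOn_of_integral S τ hnorm hint

/-- §3b (LANDED p154279).  Engine (A) is void for FINITE contractions of a NORMAL affine model
(restates `Theorems.orbitGerm_engineA_false_of_normal_of_integral`). -/
theorem engineA_void_of_normal_of_integral {k K : Type} [Field k] [Field K] [Algebra k K]
    (R : Subalgebra k K) (hR : R.FG) (P : Ideal R.toSubring) [P.IsPrime] (τ : K ≃+* K)
    (hRτ : ∀ r : K, r ∈ R → τ r ∈ R) (hnorm : ∀ x : K, IsIntegral R.toSubring x → x ∈ R)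
    (hint : ∀ r : K, r ∈ R → IsIntegral (R.toSubring.map (τ : K →+* K)) r) :
    ¬ (P ≠ ⊥ ∧ ∀ r : R.toSubring, r ∈ P → ∃ r' : R.toSubring, r' ∈ P ^ 2 ∧ (r' : K) = τ (r : K)) :=
  orbitGerm_engineA_false_of_normal_of_integral R hR P τ hRτ hnorm hint

/-- §3d (LANDED p154702).  Tightness: stub 3 is false without `P ≠ ⊥` … -/
theorem stub3_false_without_ne_bot :
    ¬ (∀ (K : Type) [Field K] (S : Subring K) (P : Ideal S) (τ : K ≃+* K), (∀ r : K, r ∈ S → τ r ∈ S) → (∀ r : S, r ∈ P → ∃ r' : S, r' ∈ P ^ 2 ∧ (r' : K) = τ (r : K)) → ∀ W : ValuationSubring K, IsDiscreteValuationRing W → S ≤ W.toSubring → (∀ r : S, r ∈ P → (r : K) ∈ W.nonunits) → Function.Injective (fun n : ℕ => W.comap ((τ ^ n : K ≃+* K) : K →+* K))) :=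
  stub_contractingInjective_false_without_ne_bot

/-- §3d (LANDED p154702).  … and false without the contraction `τ P ⊆ P²` … -/
theorem stub3_false_without_contraction :
    ¬ (∀ (K : Type) [Field K] (S : Subring K) (P : Ideal S), P ≠ ⊥ → ∀ (τ : K ≃+* K), (∀ r : K, r ∈ S → τ r ∈ S) → ∀ W : ValuationSubring K, IsDiscreteValuationRing W → S ≤ W.toSubring → (∀ r : S, r ∈ P → (r : K) ∈ W.nonunits) → Function.Injective (fun n : ℕ => W.comap ((τ ^ n : K ≃+* K) : K →+* K))) :=
  stub_contractingInjective_false_without_contraction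

/-- §3d (LANDED p154702).  … and stub 4 is false without the infinite `ι`-orbit. -/
theorem stub4_false_without_infiniteOrbit :
    ¬ (∀ (k K : Type) [Field k] [Field K] [Algebra k K] (τ : K ≃+* K) (ι : k ≃+* k), (∀ c : k, τ (algebraMap k K c) = algebraMap k K (ι c)) → ∀ W : ValuationSubring K, (∀ c : k, algebraMap k K c ∈ W) → ∀ (x : K) (a : k), τ x = x → x - algebraMap k K a ∈ W.nonunits → Function.Injective (fun n : ℕ => W.comap ((τ ^ n : K ≃+* K) : K →+* K))) :=
  stub_modulusInjective_false_without_infiniteOrbit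

end EngineA

section EngineB

/-- §3c (LANDED p153574).  Engine (B) is void over constants algebraic over `𝔽_p`
(restates `Theorems.orbitGerm_engineB_false_of_algebraic_constants`). -/
theorem engineB_void_of_algebraic_constants {p : ℕ} (hp : p.Prime) {k K : Type} [Field k]
    [CharP k p] [Field K] [Algebra k K]
    (halg : ∀ a : k, ∃ f : Polynomial (ZMod p), f ≠ 0 ∧
      Polynomial.eval₂ (ZMod.castHom (dvd_refl p) k) a f = 0)
    (τ : K ≃+* K) (ι : k ≃+* k) (W : ValuationSubring K) :
    ¬ (∃ (x : K) (a : k), τ x = x ∧ (∀ n : ℕ, 0 < n → (ι ^ n) a ≠ a) ∧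
        x - algebraMap k K a ∈ W.nonunits) :=
  orbitGerm_engineB_false_of_algebraic_constants hp halg τ ι W

/-- §3c′.  In particular engine (B) is void when `ι` is `k`-LINEAR (`ι = 1`): trivial but worth
typing — a B-germ is genuinely semilinear. -/
theorem engineB_void_of_linear {k K : Type} [Field k] [Field K] [Algebra k K] (τ : K ≃+* K)
    (W : ValuationSubring K) :
    ¬ (∃ (x : K) (a : k), τ x = x ∧ (∀ n : ℕ, 0 < n → ((1 : k ≃+* k) ^ n) a ≠ a) ∧
        x - algebraMap k K a ∈ W.nonunits) := by
  rintro ⟨x, a, -, horb, -⟩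
  exact horb 1 one_pos (by simp)

end EngineB

/-! ## §4  The regime map (one near-miss, the ONLY `sorry` of this file) and the `Sing` mutation (proved)

These are NOT claims against the crux.  The near-miss docstring says why it is true and what blocks
a Lean proof now.
-/

/-- NEAR-MISS (known true, unformalised): NRF in `trdeg ≤ 3`.  If `K/k` has a transcendence basis
with at most three elements then the witness set is FINITE for every affine model `R` — trdeg 0:
§2; trdeg 1: Krull–Akizuki (finitely many DVRs over each of the finitely many singular points);
trdeg 2: Lipman 1978 (resolution of excellent surfaces) + the route's kills; trdeg 3:
Cossart–Piltant 2019 + the kills.  OBSTRUCTION: none of surface/threefold resolution, finiteness of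
normalisation for f.g. algebras, or the kills (`NonRuledCofinite`, `RegularModelRuled`) is in the
tree yet.  CONSEQUENCE FOR HUNTERS: a witness has `trdeg_k K ≥ 4`. -/
theorem witnessSet_finite_of_trdeg_le_three {k K : Type} [Field k] [Field K] [Algebra k K]
    (R : Subalgebra k K) (hR : R.FG) (hfr : IsFractionRing R K) {ι : Type} (b : ι → K)
    (hb : IsTranscendenceBasis k b) (hcard : Cardinal.mk ι ≤ 3) : (witnessSet k K R).Finite := by
  sorry

/-- The crux with the SINGULAR-CENTRE clause deleted (everything else verbatim). -/
def NonRuledDivisorsWithoutSingularCentre : Prop :=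
  ∃ p : ℕ, p.Prime ∧ ∃ (k K : Type) (_ : Field k) (_ : CharP k p) (_ : Field K) (_ : Algebra k K), ∃ R : Subalgebra k K, R.FG ∧ IsFractionRing R K ∧ Set.Infinite {W : ValuationSubring K | ∃ hk : (∀ c : k, algebraMap k K c ∈ W), IsDiscreteValuationRing W ∧ (∃ B : Subalgebra k K, B.FG ∧ B.toSubring ≤ W.toSubring ∧ ∀ x : K, x ∈ W → ∃ b s : K, b ∈ B ∧ s ∈ B ∧ s ∉ W.nonunits ∧ x * s = b) ∧ (R.toSubring ≤ W.toSubring) ∧ ¬ (∃ (L : Subfield (IsLocalRing.ResidueField W)) (t : IsLocalRing.ResidueField W), (∀ c : k, IsLocalRing.residue W ⟨algebraMap k K c, hk c⟩ ∈ L) ∧ (∀ f : Polynomial L, f ≠ 0 → Polynomial.eval₂ L.subtype t f ≠ 0) ∧ (∀ x : IsLocalRing.ResidueField W, ∃ f g : Polynomial L, Polynomial.eval₂ L.subtype t g ≠ 0 ∧ x * Polynomial.eval₂ L.subtype t g = Polynomial.eval₂ L.subtype t f))}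

/-- LOAD-BEARING (LANDED p154560, `Negative/WithoutSingularCentreHolds.lean`): without the
singular-centre clause the crux holds trivially in `trdeg 1`: `p = 2`, `k = 𝔽̄₂` (infinite),
`K = k(X)`, `R = B = k[X]`, `W_a = k[X]_(X−a)` for `a ∈ k`; each `W_a` is a DVR, essentially of
finite type, `κ(W_a) = k` hence NOT ruled (no transcendental `t`), and `a ↦ W_a` is injective.
(In `trdeg ≥ 2` one would use height-one primes with non-rational residue varieties — genus
certificates; not needed for the load-bearing point.) -/
theorem nonRuledDivisorsWithoutSingularCentre_holds : NonRuledDivisorsWithoutSingularCentre :=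
  nonRuledDivisors_withoutSingularCentre_holds

/-! ## §5  Targets (the lead's stuck stubs): none yet (no lead seated; `stuck_stubs = []`). -/

end Summit.ResolutionOfSingularities.ResolutionOfSingularities.Cruxes.NonRuledDivisors.Disproof
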